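import Summits.Parity.GeneralizedHardyLittlewood.Theorems.PrimeLevelFamEdgeMomentsBeyondDiagonalDictionaryAtOneTruncation
import HarnessLib

/-!
# Route `PrimeLevelFamEdge`, crux K_A `MomentsBeyondDiagonal` (stmt-Parity-20007), line «petersson_layers» v4:
# THE IDENTIFICATION AT `Q = 1`, part A — the BOX error (layers `r > q⁸`) is `≤ A_P · q̂⁻¹`
# (lead prover, 2026-08-28; helper toward the `Q = 1` slice of the registered stub `stub_identP : TailNearFar rhoP`)

* §0 bookkeeping at level `q ≥ 64`: `1 < M = q̂^{Δ'} ≤ q̂^{3/2}`, `⌊M⌋ < q` for `Δ' ≤ 3/2`; `q̂^α ≤ q^{α/2}`, `q^{−s} ≤ q̂^{−2s}`;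
  the weight `(n₁n₂)^{−1/2}W(n₁n₂/q̂²)` against `(n₁n₂)^{3/4}` is `≤ 12 q̂³ n₁^{−5/4}n₂^{−5/4}`.
* §1 `norm_boxSum_le`: for `q` prime `≥ 64`, `0 < Δ' ≤ 3/2`:
  `‖Σ_{n₁,n₂ ≤ q²} (n₁n₂)^{−1/2}W(n₁n₂/q̂²) Σ_{m₁,m₂ ≤ M} x_{m₁}x_{m₂} Σ_{d₁,d₂} (Σʰλ_f(a)λ_f(b) − [δ(a,b) − Σ_{r ≤ q⁸} K_r(a,b)])‖
  ≤ A_P · q̂⁻¹` (Petersson leaves `−Σ_{r>q⁸}K_r`; Weil; `|x_m| ≤ ‖P‖m^{−1/2}`; divisor bound; `W(y) ≤ 12y^{−3/2}`).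
Part B (off-box error and the conclusion `‖tail + far‖ ≤ C_P`) follows in `…IdentificationAtOne`. Unconditional; nothing here is a
moment ASYMPTOTIC or a statement about `stub_core` / K_A; no exceptional-zero claim (no GRH, no Landau–Siegel).
-/

noncomputable section

open scoped MatrixGroups Real Nat
open CongruenceSubgroup Complex Finset Polynomial MeasureTheory
open Literature.NumberTheory.EllipticCurves.ModularForms
open Literature.NumberTheory.LFunctions

namespace Summit.Parity.GeneralizedHardyLittlewood.Theorems.PrimeLevelFamEdgeIdeaDeltas.PeterssonLayers

/-! ## §0. Level bookkeeping: `q̂`, `M = q̂^{Δ'}`, the AFE box -/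

/-- For `q ≥ 64` and `0 < Δ' ≤ 3/2`: `1 < M = q̂^{Δ'}`, `M ≤ q̂^{3/2}`, and `⌊M⌋ < q`. -/
theorem mollifierLength_facts {q : ℕ} (hq : 64 ≤ q) {Δ' : ℝ} (h0 : 0 < Δ') (h32 : Δ' ≤ 3 / 2) :
    1 < KMV2000.qhat q ^ Δ' ∧ KMV2000.qhat q ^ Δ' ≤ KMV2000.qhat q ^ (3 / 2 : ℝ) ∧
      ⌊KMV2000.qhat q ^ Δ'⌋₊ < q := by
  have h1 : 1 < KMV2000.qhat q := one_lt_qhat hq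
  have hq1 : (1 : ℝ) ≤ q := by exact_mod_cast le_trans (by norm_num) hq
  refine ⟨Real.one_lt_rpow h1 h0, Real.rpow_le_rpow_of_exponent_le h1.le h32, ?_⟩
  have hM : KMV2000.qhat q ^ Δ' < q := by
    calc KMV2000.qhat q ^ Δ' ≤ KMV2000.qhat q ^ (3 / 2 : ℝ) := Real.rpow_le_rpow_of_exponent_le h1.le h32
      _ ≤ (Real.sqrt q) ^ (3 / 2 : ℝ) :=
          Real.rpow_le_rpow (zero_le_one.trans h1.le) KMV2000.qhat_le_sqrt (by norm_num)
      _ = (q : ℝ) ^ (3 / 4 : ℝ) := by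
          rw [Real.sqrt_eq_rpow, ← Real.rpow_mul (by positivity)]; norm_num
      _ < (q : ℝ) ^ (1 : ℝ) := Real.rpow_lt_rpow_of_exponent_lt (by
          have : (64 : ℝ) ≤ q := by exact_mod_cast hq
          linarith) (by norm_num)
      _ = q := Real.rpow_one _
  exact (Nat.floor_lt (zero_le_one.trans (Real.one_lt_rpow h1 h0).le)).mpr hM

/-- `q̂^α ≤ q^{α/2}` for `α ≥ 0` (`q̂ ≤ √q`). -/
theorem qhat_rpow_le {q : ℕ} [NeZero q] {α : ℝ} (hα : 0 ≤ α) :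
    KMV2000.qhat q ^ α ≤ (q : ℝ) ^ (α / 2) := by
  have h0 : 0 ≤ KMV2000.qhat q := (KMV2000.qhat_pos_of_neZero q).le
  calc KMV2000.qhat q ^ α ≤ (Real.sqrt q) ^ α := Real.rpow_le_rpow h0 KMV2000.qhat_le_sqrt hα
    _ = (q : ℝ) ^ (α / 2) := by rw [Real.sqrt_eq_rpow, ← Real.rpow_mul (by positivity)]; ring_nf

/-- `1 ≤ a = mn/d²` for `d ∣ (m,n)`, `m, n ≥ 1`. -/
theorem one_le_mul_div_sq {m n d : ℕ} (hd : d ∈ (Nat.gcd m n).divisors) (hm : 1 ≤ m) (hn : 1 ≤ n) :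
    1 ≤ m * n / d ^ 2 := by
  have hd' : d ∣ Nat.gcd m n := Nat.dvd_of_mem_divisors hd
  have hdd : d ^ 2 ∣ m * n := by
    rw [sq]; exact Nat.mul_dvd_mul (hd'.trans (Nat.gcd_dvd_left _ _)) (hd'.trans (Nat.gcd_dvd_right _ _))
  have hpos : 0 < m * n := Nat.mul_pos (by omega) (by omega)
  have hdpos : 0 < d := Nat.pos_of_mem_divisors hd
  exact Nat.div_pos (Nat.le_of_dvd hpos hdd) (by positivity)

/-- The cusp-form-free weight `(n₁n₂)^{−1/2} W(n₁n₂/q̂²)` has norm `(n₁n₂)^{−1/2} W(n₁n₂/q̂²)` (both factors `≥ 0`). -/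
theorem norm_weight_eq {q : ℕ} [NeZero q] (n₁ n₂ : ℕ) :
    ‖((((n₁ : ℝ) * n₂) ^ (-(1 / 2 : ℝ)) : ℝ) : ℂ) *
        ((KMV2000.cutoffW ((n₁ : ℝ) * n₂ / KMV2000.qhat q ^ 2) : ℝ) : ℂ)‖ =
      (((n₁ : ℝ) * n₂) ^ (-(1 / 2 : ℝ))) * KMV2000.cutoffW ((n₁ : ℝ) * n₂ / KMV2000.qhat q ^ 2) := by
  rw [norm_mul, Complex.norm_real, Complex.norm_real, Real.norm_eq_abs, Real.norm_eq_abs,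
    abs_of_nonneg (Real.rpow_nonneg (by positivity) _), abs_of_nonneg (KMV2000.cutoffW_nonneg _)]

/-- In the box, `(n₁n₂)^{−1/2} W(n₁n₂/q̂²) · (n₁n₂)^{3/4} ≤ 12 q̂³ · n₁^{−5/4} n₂^{−5/4}` (`W(y) ≤ 2·3!·y^{−3/2}`). -/
theorem weight_mul_rpow_le {q : ℕ} [NeZero q] {n₁ n₂ : ℕ} (h₁ : n₁ ≠ 0) (h₂ : n₂ ≠ 0) :
    (((n₁ : ℝ) * n₂) ^ (-(1 / 2 : ℝ))) * KMV2000.cutoffW ((n₁ : ℝ) * n₂ / KMV2000.qhat q ^ 2) *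
        (((n₁ : ℝ) * n₂) ^ (3 / 4 : ℝ)) ≤
      12 * KMV2000.qhat q ^ (3 : ℝ) * (((n₁ : ℝ)) ^ (-(5 / 4 : ℝ)) * ((n₂ : ℝ)) ^ (-(5 / 4 : ℝ))) := by
  have hq : 0 < KMV2000.qhat q := KMV2000.qhat_pos_of_neZero q
  have hn₁ : (0 : ℝ) < n₁ := by exact_mod_cast Nat.pos_of_ne_zero h₁
  have hn₂ : (0 : ℝ) < n₂ := by exact_mod_cast Nat.pos_of_ne_zero h₂
  have hN : (0 : ℝ) < (n₁ : ℝ) * n₂ := mul_pos hn₁ hn₂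
  have hy : 0 < (n₁ : ℝ) * n₂ / KMV2000.qhat q ^ 2 := by positivity
  have hW0 := cutoffW_le_factorial_mul_rpow hy 3
  have hW : KMV2000.cutoffW ((n₁ : ℝ) * n₂ / KMV2000.qhat q ^ 2) ≤
      12 * ((n₁ : ℝ) * n₂ / KMV2000.qhat q ^ 2) ^ (-(3 / 2 : ℝ)) := by
    have h3 : ((3 ! : ℕ) : ℝ) = 6 := by norm_num [Nat.factorial]
    have he : (-(((3 : ℕ) : ℝ) / 2)) = (-(3 / 2 : ℝ)) := by norm_num
    rw [h3, he] at hW0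
    linarith
  have hW' : KMV2000.cutoffW ((n₁ : ℝ) * n₂ / KMV2000.qhat q ^ 2) ≤
      12 * (((n₁ : ℝ) * n₂) ^ (-(3 / 2 : ℝ)) * KMV2000.qhat q ^ (3 : ℝ)) := by
    have e : ((n₁ : ℝ) * n₂ / KMV2000.qhat q ^ 2) ^ (-(3 / 2 : ℝ)) =
        ((n₁ : ℝ) * n₂) ^ (-(3 / 2 : ℝ)) * KMV2000.qhat q ^ (3 : ℝ) := by
      rw [Real.div_rpow hN.le (pow_nonneg hq.le 2), Real.rpow_neg (pow_nonneg hq.le 2), div_inv_eq_mul,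
        ← Real.rpow_natCast (KMV2000.qhat q) 2, ← Real.rpow_mul hq.le]
      norm_num
    rw [← e]
    exact hW
  have e2 : ((n₁ : ℝ) * n₂) ^ (-(1 / 2 : ℝ)) * (((n₁ : ℝ) * n₂) ^ (-(3 / 2 : ℝ))) * ((n₁ : ℝ) * n₂) ^ (3 / 4 : ℝ) =
      ((n₁ : ℝ)) ^ (-(5 / 4 : ℝ)) * ((n₂ : ℝ)) ^ (-(5 / 4 : ℝ)) := by
    rw [← Real.rpow_add hN, ← Real.rpow_add hN, ← Real.mul_rpow hn₁.le hn₂.le]; norm_num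
  calc (((n₁ : ℝ) * n₂) ^ (-(1 / 2 : ℝ))) * KMV2000.cutoffW ((n₁ : ℝ) * n₂ / KMV2000.qhat q ^ 2) *
        (((n₁ : ℝ) * n₂) ^ (3 / 4 : ℝ))
      ≤ (((n₁ : ℝ) * n₂) ^ (-(1 / 2 : ℝ))) * (12 * (((n₁ : ℝ) * n₂) ^ (-(3 / 2 : ℝ)) * KMV2000.qhat q ^ (3 : ℝ))) *
        (((n₁ : ℝ) * n₂) ^ (3 / 4 : ℝ)) := by gcongr
    _ = 12 * KMV2000.qhat q ^ (3 : ℝ) *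
        (((n₁ : ℝ) * n₂) ^ (-(1 / 2 : ℝ)) * (((n₁ : ℝ) * n₂) ^ (-(3 / 2 : ℝ))) * ((n₁ : ℝ) * n₂) ^ (3 / 4 : ℝ)) := by
        ring
    _ = _ := by rw [e2]

/-- `q^{−s} ≤ q̂^{−2s}` for `s ≥ 0` (`q̂² = q/4π² ≤ q`). -/
theorem level_rpow_neg_le {q : ℕ} [NeZero q] {s : ℝ} (hs : 0 ≤ s) :
    ((q : ℝ)) ^ (-s) ≤ KMV2000.qhat q ^ (-(2 * s)) := by
  have hqh : 0 < KMV2000.qhat q := KMV2000.qhat_pos_of_neZero q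
  have hq0 : (0 : ℝ) < q := by exact_mod_cast NeZero.pos q
  have hle : KMV2000.qhat q ^ 2 ≤ (q : ℝ) := by
    have h1 : KMV2000.qhat q ^ 2 ≤ Real.sqrt q ^ 2 := by
      gcongr
      exact KMV2000.qhat_le_sqrt
    rwa [Real.sq_sqrt hq0.le] at h1
  calc ((q : ℝ)) ^ (-s) ≤ (KMV2000.qhat q ^ 2) ^ (-s) :=
        Real.rpow_le_rpow_of_nonpos (by positivity) hle (by linarith)
    _ = KMV2000.qhat q ^ (-(2 * s)) := by
        rw [← Real.rpow_natCast, ← Real.rpow_mul hqh.le]; norm_num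

/-! ## §1. The box error: layers `r > q⁸` inside the AFE box -/

/-- **§1.** For `q` prime `≥ 64` and `0 < Δ' ≤ 3/2` (`M = q̂^{Δ'}`): the box part of the truncation error is `≤ A_P · q̂⁻¹`:
`‖Σ_{n₁,n₂ ≤ q²} (n₁n₂)^{−1/2}W(n₁n₂/q̂²) Σ_{m₁,m₂ ≤ M} x_{m₁}x_{m₂} Σ_{d₁,d₂} (Σʰλ_f(a)λ_f(b) − [δ(a,b) − Σ_{r ≤ q⁸} K_r(a,b)])‖
≤ A_P q̂⁻¹` (each inner bracket is `−Σ_{r > q⁸} K_r(a,b) ≪ (ab)^{3/4} q^{−3/2} q^{−16/5}` by Weil; then `|x_m| ≤ ‖P‖m^{−1/2}`, divisor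
bound, `W(y) ≤ 12 y^{−3/2}`). -/
theorem norm_boxSum_le (P : ℝ[X]) :
    ∃ A : ℝ, 0 ≤ A ∧ ∀ (q : ℕ) [NeZero q], q.Prime → 64 ≤ q → ∀ Δ' : ℝ, 0 < Δ' → Δ' ≤ 3 / 2 →
      ‖∑ n₁ ∈ afeBox q, ∑ n₂ ∈ afeBox q,
          ((((n₁ : ℝ) * n₂) ^ (-(1 / 2 : ℝ)) : ℝ) : ℂ) *
            ((KMV2000.cutoffW ((n₁ : ℝ) * n₂ / KMV2000.qhat q ^ 2) : ℝ) : ℂ) *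
          ∑ m₁ ∈ Icc 1 ⌊KMV2000.qhat q ^ Δ'⌋₊, ∑ m₂ ∈ Icc 1 ⌊KMV2000.qhat q ^ Δ'⌋₊,
            (KMV2000.mollifierCoeff P (KMV2000.qhat q ^ Δ') m₁ : ℂ) *
              (KMV2000.mollifierCoeff P (KMV2000.qhat q ^ Δ') m₂ : ℂ) *
            ∑ d₁ ∈ (Nat.gcd m₁ n₁).divisors, ∑ d₂ ∈ (Nat.gcd m₂ n₂).divisors,
              (KowalskiMichel2000.pet q (m₁ * n₁ / d₁ ^ 2) (m₂ * n₂ / d₂ ^ 2) -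
                (diagKernel (m₁ * n₁ / d₁ ^ 2) (m₂ * n₂ / d₂ ^ 2) -
                  ∑ r ∈ Icc 1 (q ^ 8), layerKernel q r (m₁ * n₁ / d₁ ^ 2) (m₂ * n₂ / d₂ ^ 2)))‖ ≤
        A * (KMV2000.qhat q)⁻¹ := by
  obtain ⟨A₀, hA₀0, hA₀⟩ := exists_norm_tsum_layerKernel_tail_le
  obtain ⟨C, hC1, hC⟩ :=
    Literature.NumberTheory.Sieve.exists_card_divisors_le_mul_rpow' (by norm_num : (0 : ℝ) < 1 / 20)
  have hC0 : 0 ≤ C := zero_le_one.trans hC1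
  set B : ℝ := ∑ i ∈ range (P.natDegree + 1), |P.coeff i| with hBdef
  have hB : ∀ t ∈ Set.Icc (0 : ℝ) 1, |P.eval t| ≤ B := fun t ht ↦ abs_eval_le_sum_abs_coeff P ht
  have hZs : Summable (fun n : ℕ ↦ ((n : ℝ)) ^ (-(5 / 4 : ℝ))) := Real.summable_nat_rpow.mpr (by norm_num)
  set Z₁ : ℝ := ∑' n : ℕ, ((n : ℝ)) ^ (-(5 / 4 : ℝ)) with hZ₁
  have hZ₁0 : 0 ≤ Z₁ := tsum_nonneg fun n ↦ Real.rpow_nonneg (Nat.cast_nonneg _) _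
  refine ⟨A₀ * B ^ 2 * C ^ 2 * 12 * Z₁ ^ 2, by positivity, fun q _ hq h64 Δ' h0 h32 ↦ ?_⟩
  obtain ⟨hM1, hM32, hMq⟩ := mollifierLength_facts h64 h0 h32
  have hqh1 : 1 < KMV2000.qhat q := one_lt_qhat h64
  have hqh0 : 0 < KMV2000.qhat q := zero_lt_one.trans hqh1
  have hq0 : (0 : ℝ) < q := by exact_mod_cast hq.pos
  set M : ℝ := KMV2000.qhat q ^ Δ' with hMdef
  set R : ℕ := q ^ 8 with hRdef
  -- the constant in front of `(ab)^{3/4}` for the inner kernel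
  set c : ℝ := A₀ * ((q : ℝ)) ^ (-(3 / 2 : ℝ)) * (((R + 1 : ℕ) : ℝ)) ^ (-(2 / 5 : ℝ)) with hcdef
  have hc0 : 0 ≤ c := by positivity
  -- the inner kernel bound: `‖pet − κ_R‖ ≤ c (ab)^{3/4}`
  have hG : ∀ n₁ n₂ : ℕ, n₁ ≠ 0 → n₂ ≠ 0 →
      ∀ m₁ ∈ Icc 1 ⌊M⌋₊, ∀ m₂ ∈ Icc 1 ⌊M⌋₊, ∀ d₁ ∈ (Nat.gcd m₁ n₁).divisors, ∀ d₂ ∈ (Nat.gcd m₂ n₂).divisors,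
      ‖(fun a b ↦ KowalskiMichel2000.pet q a b -
          (diagKernel a b - ∑ r ∈ Icc 1 R, layerKernel q r a b)) (m₁ * n₁ / d₁ ^ 2) (m₂ * n₂ / d₂ ^ 2)‖ ≤
        c * ((((m₁ * n₁ / d₁ ^ 2 : ℕ) : ℝ)) * ((m₂ * n₂ / d₂ ^ 2 : ℕ) : ℝ)) ^ (3 / 4 : ℝ) := by
    intro n₁ n₂ hn₁ hn₂ m₁ hm₁ m₂ hm₂ d₁ hd₁ d₂ hd₂
    have hm₁' := (Finset.mem_Icc.mp hm₁).1
    have hm₂' := (Finset.mem_Icc.mp hm₂).1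
    have ha : 1 ≤ m₁ * n₁ / d₁ ^ 2 := one_le_mul_div_sq hd₁ hm₁' (Nat.one_le_iff_ne_zero.mpr hn₁)
    have hb : 1 ≤ m₂ * n₂ / d₂ ^ 2 := one_le_mul_div_sq hd₂ hm₂' (Nat.one_le_iff_ne_zero.mpr hn₂)
    simp only
    rw [pet_sub_kernel_eq_neg_tsum hq ha hb R, norm_neg]
    refine (hA₀ q hq _ _ R ha).trans ?_
    have hs := sqrt_gcd_mul_sqrt_le ha hb
    rw [hcdef]
    have : A₀ * Real.sqrt (((m₁ * n₁ / d₁ ^ 2 : ℕ).gcd (m₂ * n₂ / d₂ ^ 2) : ℕ) : ℝ) *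
        Real.sqrt (((m₁ * n₁ / d₁ ^ 2 : ℕ) : ℝ) * ((m₂ * n₂ / d₂ ^ 2 : ℕ) : ℝ)) *
        ((q : ℝ)) ^ (-(3 / 2 : ℝ)) * (((R + 1 : ℕ) : ℝ)) ^ (-(2 / 5 : ℝ)) =
        (A₀ * ((q : ℝ)) ^ (-(3 / 2 : ℝ)) * (((R + 1 : ℕ) : ℝ)) ^ (-(2 / 5 : ℝ))) *
          (Real.sqrt (((m₁ * n₁ / d₁ ^ 2 : ℕ).gcd (m₂ * n₂ / d₂ ^ 2) : ℕ) : ℝ) *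
            Real.sqrt (((m₁ * n₁ / d₁ ^ 2 : ℕ) : ℝ) * ((m₂ * n₂ / d₂ ^ 2 : ℕ) : ℝ))) := by ring
    rw [this]
    exact mul_le_mul_of_nonneg_left hs (by positivity)
  -- the mollifier sum `S = Σ_m m^{3/10} ≤ M^{13/10}`
  set S : ℝ := ∑ m ∈ Icc 1 ⌊M⌋₊, ((m : ℝ)) ^ (3 / 4 - 1 / 2 + 1 / 20 : ℝ) with hSdef
  have hS0 : 0 ≤ S := Finset.sum_nonneg fun m _ ↦ Real.rpow_nonneg (Nat.cast_nonneg _) _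
  have hSle : S ≤ M ^ (13 / 10 : ℝ) := by
    have h := sum_Icc_rpow_le (M := M) (e := 3 / 10) hM1.le (by norm_num)
    have e1 : (3 / 4 - 1 / 2 + 1 / 20 : ℝ) = 3 / 10 := by norm_num
    have e2 : (3 / 10 + 1 : ℝ) = 13 / 10 := by norm_num
    rw [hSdef, e1]; rw [e2] at h; exact h
  -- inner bound at each box point
  have hinner : ∀ n₁ ∈ afeBox q, ∀ n₂ ∈ afeBox q,
      ‖∑ m₁ ∈ Icc 1 ⌊M⌋₊, ∑ m₂ ∈ Icc 1 ⌊M⌋₊,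
          (KMV2000.mollifierCoeff P M m₁ : ℂ) * (KMV2000.mollifierCoeff P M m₂ : ℂ) *
          ∑ d₁ ∈ (Nat.gcd m₁ n₁).divisors, ∑ d₂ ∈ (Nat.gcd m₂ n₂).divisors,
            (KowalskiMichel2000.pet q (m₁ * n₁ / d₁ ^ 2) (m₂ * n₂ / d₂ ^ 2) -
              (diagKernel (m₁ * n₁ / d₁ ^ 2) (m₂ * n₂ / d₂ ^ 2) -
                ∑ r ∈ Icc 1 R, layerKernel q r (m₁ * n₁ / d₁ ^ 2) (m₂ * n₂ / d₂ ^ 2)))‖ ≤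
        c * B ^ 2 * C ^ 2 * (((n₁ : ℝ) * n₂) ^ (3 / 4 : ℝ)) * S ^ 2 := by
    intro n₁ hn₁ n₂ hn₂
    have h := norm_mollifierPairSum_le hB hM1 hC (by norm_num : (0 : ℝ) ≤ 3 / 4) hc0 n₁ n₂
      (fun a b ↦ KowalskiMichel2000.pet q a b - (diagKernel a b - ∑ r ∈ Icc 1 R, layerKernel q r a b))
      (hG n₁ n₂ (ne_zero_of_mem_afeBox hn₁) (ne_zero_of_mem_afeBox hn₂))
    simpa only using h
  -- the weight against `(n₁n₂)^{3/4}`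
  have hwt : ∀ n₁ ∈ afeBox q, ∀ n₂ ∈ afeBox q,
      ‖((((n₁ : ℝ) * n₂) ^ (-(1 / 2 : ℝ)) : ℝ) : ℂ) *
          ((KMV2000.cutoffW ((n₁ : ℝ) * n₂ / KMV2000.qhat q ^ 2) : ℝ) : ℂ)‖ * (((n₁ : ℝ) * n₂) ^ (3 / 4 : ℝ)) ≤
        12 * KMV2000.qhat q ^ (3 : ℝ) * (((n₁ : ℝ)) ^ (-(5 / 4 : ℝ)) * ((n₂ : ℝ)) ^ (-(5 / 4 : ℝ))) := by
    intro n₁ hn₁ n₂ hn₂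
    rw [norm_weight_eq]
    exact weight_mul_rpow_le (ne_zero_of_mem_afeBox hn₁) (ne_zero_of_mem_afeBox hn₂)
  -- `Σ_{n ∈ box} n^{-5/4} ≤ Z₁`
  have hbox : ∑ n ∈ afeBox q, ((n : ℝ)) ^ (-(5 / 4 : ℝ)) ≤ Z₁ :=
    hZs.sum_le_tsum (afeBox q) (fun n _ ↦ Real.rpow_nonneg (Nat.cast_nonneg _) _)
  have hbox0 : 0 ≤ ∑ n ∈ afeBox q, ((n : ℝ)) ^ (-(5 / 4 : ℝ)) :=
    Finset.sum_nonneg fun n _ ↦ Real.rpow_nonneg (Nat.cast_nonneg _) _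
  -- assemble the box sum
  have hmain : ‖∑ n₁ ∈ afeBox q, ∑ n₂ ∈ afeBox q,
          ((((n₁ : ℝ) * n₂) ^ (-(1 / 2 : ℝ)) : ℝ) : ℂ) *
            ((KMV2000.cutoffW ((n₁ : ℝ) * n₂ / KMV2000.qhat q ^ 2) : ℝ) : ℂ) *
          ∑ m₁ ∈ Icc 1 ⌊M⌋₊, ∑ m₂ ∈ Icc 1 ⌊M⌋₊,
            (KMV2000.mollifierCoeff P M m₁ : ℂ) * (KMV2000.mollifierCoeff P M m₂ : ℂ) *
            ∑ d₁ ∈ (Nat.gcd m₁ n₁).divisors, ∑ d₂ ∈ (Nat.gcd m₂ n₂).divisors,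
              (KowalskiMichel2000.pet q (m₁ * n₁ / d₁ ^ 2) (m₂ * n₂ / d₂ ^ 2) -
                (diagKernel (m₁ * n₁ / d₁ ^ 2) (m₂ * n₂ / d₂ ^ 2) -
                  ∑ r ∈ Icc 1 R, layerKernel q r (m₁ * n₁ / d₁ ^ 2) (m₂ * n₂ / d₂ ^ 2)))‖ ≤
        c * B ^ 2 * C ^ 2 * S ^ 2 * (12 * KMV2000.qhat q ^ (3 : ℝ)) * Z₁ ^ 2 := by
    calc _ ≤ ∑ n₁ ∈ afeBox q, ∑ n₂ ∈ afeBox q,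
          ‖((((n₁ : ℝ) * n₂) ^ (-(1 / 2 : ℝ)) : ℝ) : ℂ) *
            ((KMV2000.cutoffW ((n₁ : ℝ) * n₂ / KMV2000.qhat q ^ 2) : ℝ) : ℂ)‖ *
            (c * B ^ 2 * C ^ 2 * (((n₁ : ℝ) * n₂) ^ (3 / 4 : ℝ)) * S ^ 2) := by
          refine (norm_sum_le _ _).trans (Finset.sum_le_sum fun n₁ hn₁ ↦ ?_)
          refine (norm_sum_le _ _).trans (Finset.sum_le_sum fun n₂ hn₂ ↦ ?_)
          rw [norm_mul]
          exact mul_le_mul_of_nonneg_left (hinner n₁ hn₁ n₂ hn₂) (norm_nonneg _)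
      _ = c * B ^ 2 * C ^ 2 * S ^ 2 * ∑ n₁ ∈ afeBox q, ∑ n₂ ∈ afeBox q,
          ‖((((n₁ : ℝ) * n₂) ^ (-(1 / 2 : ℝ)) : ℝ) : ℂ) *
            ((KMV2000.cutoffW ((n₁ : ℝ) * n₂ / KMV2000.qhat q ^ 2) : ℝ) : ℂ)‖ * (((n₁ : ℝ) * n₂) ^ (3 / 4 : ℝ)) := by
          rw [Finset.mul_sum]
          refine Finset.sum_congr rfl fun n₁ _ ↦ ?_
          rw [Finset.mul_sum]
          refine Finset.sum_congr rfl fun n₂ _ ↦ ?_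
          ring
      _ ≤ c * B ^ 2 * C ^ 2 * S ^ 2 * ∑ n₁ ∈ afeBox q, ∑ n₂ ∈ afeBox q,
          12 * KMV2000.qhat q ^ (3 : ℝ) * (((n₁ : ℝ)) ^ (-(5 / 4 : ℝ)) * ((n₂ : ℝ)) ^ (-(5 / 4 : ℝ))) := by
          exact mul_le_mul_of_nonneg_left
            (Finset.sum_le_sum fun n₁ hn₁ ↦ Finset.sum_le_sum fun n₂ hn₂ ↦ hwt n₁ hn₁ n₂ hn₂)
            (mul_nonneg (mul_nonneg (mul_nonneg hc0 (sq_nonneg _)) (sq_nonneg _)) (sq_nonneg _))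
      _ = c * B ^ 2 * C ^ 2 * S ^ 2 * (12 * KMV2000.qhat q ^ (3 : ℝ)) *
          (∑ n ∈ afeBox q, ((n : ℝ)) ^ (-(5 / 4 : ℝ))) ^ 2 := by
          rw [pow_two (∑ n ∈ afeBox q, ((n : ℝ)) ^ (-(5 / 4 : ℝ))), Finset.sum_mul_sum, Finset.mul_sum,
            Finset.mul_sum]
          refine Finset.sum_congr rfl fun n₁ _ ↦ ?_
          rw [Finset.mul_sum, Finset.mul_sum]
          refine Finset.sum_congr rfl fun n₂ _ ↦ ?_
          ring
      _ ≤ c * B ^ 2 * C ^ 2 * S ^ 2 * (12 * KMV2000.qhat q ^ (3 : ℝ)) * Z₁ ^ 2 := by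
          gcongr
  refine hmain.trans ?_
  -- exponent bookkeeping: `c S² q̂³ ≤ A₀ q̂^{-5/2} ≤ A₀ q̂⁻¹`
  have hS2 : S ^ 2 ≤ KMV2000.qhat q ^ (39 / 10 : ℝ) := by
    calc S ^ 2 ≤ (M ^ (13 / 10 : ℝ)) ^ 2 := by gcongr
      _ = KMV2000.qhat q ^ (Δ' * (13 / 5) : ℝ) := by
          rw [hMdef, ← Real.rpow_natCast, ← Real.rpow_mul (Real.rpow_nonneg hqh0.le _),
            ← Real.rpow_mul hqh0.le]; norm_num
      _ ≤ KMV2000.qhat q ^ (39 / 10 : ℝ) :=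
          Real.rpow_le_rpow_of_exponent_le hqh1.le (by nlinarith)
  have hq32 : ((q : ℝ)) ^ (-(3 / 2 : ℝ)) ≤ KMV2000.qhat q ^ (-(3 : ℝ)) := by
    have h := level_rpow_neg_le (q := q) (s := 3 / 2) (by norm_num)
    rw [show (2 * (3 / 2 : ℝ)) = 3 by norm_num] at h
    exact h
  have hR : (((R + 1 : ℕ) : ℝ)) ^ (-(2 / 5 : ℝ)) ≤ KMV2000.qhat q ^ (-(32 / 5 : ℝ)) := by
    have h1 : ((q : ℝ)) ^ (8 : ℝ) ≤ (((R + 1 : ℕ) : ℝ)) := by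
      rw [hRdef]; push_cast
      rw [show ((8 : ℝ)) = ((8 : ℕ) : ℝ) by norm_num, Real.rpow_natCast]
      linarith
    have h2 : (((R + 1 : ℕ) : ℝ)) ^ (-(2 / 5 : ℝ)) ≤ (((q : ℝ)) ^ (8 : ℝ)) ^ (-(2 / 5 : ℝ)) :=
      Real.rpow_le_rpow_of_nonpos (by positivity) h1 (by norm_num)
    refine h2.trans ?_
    rw [← Real.rpow_mul hq0.le, show ((8 : ℝ) * -(2 / 5 : ℝ)) = -(16 / 5 : ℝ) by norm_num]
    have h3 := level_rpow_neg_le (q := q) (s := 16 / 5) (by norm_num)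
    rw [show (2 * (16 / 5 : ℝ)) = 32 / 5 by norm_num] at h3
    exact h3
  have hcS : c * S ^ 2 * (12 * KMV2000.qhat q ^ (3 : ℝ)) ≤ 12 * A₀ * (KMV2000.qhat q)⁻¹ := by
    calc c * S ^ 2 * (12 * KMV2000.qhat q ^ (3 : ℝ))
        ≤ (A₀ * KMV2000.qhat q ^ (-(3 : ℝ)) * KMV2000.qhat q ^ (-(32 / 5 : ℝ))) *
            KMV2000.qhat q ^ (39 / 10 : ℝ) * (12 * KMV2000.qhat q ^ (3 : ℝ)) := by
          have hcle : c ≤ A₀ * KMV2000.qhat q ^ (-(3 : ℝ)) * KMV2000.qhat q ^ (-(32 / 5 : ℝ)) := by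
            rw [hcdef]
            exact mul_le_mul (mul_le_mul_of_nonneg_left hq32 hA₀0) hR (by positivity) (by positivity)
          exact mul_le_mul_of_nonneg_right (mul_le_mul hcle hS2 (sq_nonneg _) (by positivity)) (by positivity)
      _ = 12 * A₀ * KMV2000.qhat q ^ (-(5 / 2 : ℝ)) := by
          have e : KMV2000.qhat q ^ (-(3 : ℝ)) * KMV2000.qhat q ^ (-(32 / 5 : ℝ)) * KMV2000.qhat q ^ (39 / 10 : ℝ) *
              KMV2000.qhat q ^ (3 : ℝ) = KMV2000.qhat q ^ (-(5 / 2 : ℝ)) := by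
            rw [← Real.rpow_add hqh0, ← Real.rpow_add hqh0, ← Real.rpow_add hqh0]; norm_num
          calc (A₀ * KMV2000.qhat q ^ (-(3 : ℝ)) * KMV2000.qhat q ^ (-(32 / 5 : ℝ))) *
                KMV2000.qhat q ^ (39 / 10 : ℝ) * (12 * KMV2000.qhat q ^ (3 : ℝ))
              = 12 * A₀ * (KMV2000.qhat q ^ (-(3 : ℝ)) * KMV2000.qhat q ^ (-(32 / 5 : ℝ)) *
                  KMV2000.qhat q ^ (39 / 10 : ℝ) * KMV2000.qhat q ^ (3 : ℝ)) := by ring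
            _ = _ := by rw [e]
      _ ≤ 12 * A₀ * (KMV2000.qhat q)⁻¹ := by
          have h : KMV2000.qhat q ^ (-(5 / 2 : ℝ)) ≤ (KMV2000.qhat q)⁻¹ := by
            rw [← Real.rpow_neg_one]
            exact Real.rpow_le_rpow_of_exponent_le hqh1.le (by norm_num)
          exact mul_le_mul_of_nonneg_left h (by positivity)
  calc c * B ^ 2 * C ^ 2 * S ^ 2 * (12 * KMV2000.qhat q ^ (3 : ℝ)) * Z₁ ^ 2
      = B ^ 2 * C ^ 2 * Z₁ ^ 2 * (c * S ^ 2 * (12 * KMV2000.qhat q ^ (3 : ℝ))) := by ring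
    _ ≤ B ^ 2 * C ^ 2 * Z₁ ^ 2 * (12 * A₀ * (KMV2000.qhat q)⁻¹) := by gcongr
    _ = A₀ * B ^ 2 * C ^ 2 * 12 * Z₁ ^ 2 * (KMV2000.qhat q)⁻¹ := by ring

end Summit.Parity.GeneralizedHardyLittlewood.Theorems.PrimeLevelFamEdgeIdeaDeltas.PeterssonLayers

end
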